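import Mathlib.Analysis.SpecialFunctions.Trigonometric.ArctanDeriv
import Mathlib.Analysis.SpecialFunctions.Integrals.Basic
import Mathlib.MeasureTheory.Function.JacobianOneDim
import Mathlib.MeasureTheory.Integral.IntervalIntegral.FundThmCalculus
import Summits.NavierStokesRegularity.OSWSelfSimilar.SheetRWeightedEmbeddings
import HarnessLib

/-!
# SHEET-ℝ frame: the Cayley substitution `ξ = L·tan(θ/2)` — change of variables, weight identities,
# orthogonality of the frame functions (E1), and the H-free half of the velocity clause

HONEST FRAMING (cell ns-blowup GROUP B / zone Z3, case Z3-SR-CERT; 1-D MODEL certificate frame; not Euler/NS).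

The certificate frame of the ℝ point (cert-1 `SHEET-R-PRICE-impl1.md` §1, selfsim FRAME-NOTE-v2) works in the Cayley variable
`ξ = L tan(θ/2)`, `θ ∈ (−π, π)`, `L > 0`, with weight `w = L² + ξ²` and frame functions `e_n(ξ) = (1 + cos θ)·sin nθ`,
`θ = θ(ξ) = 2·arctan(ξ/L)`. This file is the kernel form of the substitution bookkeeping (item (E1) of the price memo and the
measure identity behind it); everything is elementary calculus, no Hilbert transform appears (item (E2), `H e_n = −(1 + cos θ)cos nθ`,
is typed separately by the selfsim seat; the velocity clause `𝒰e_n = −(L/n) sin nθ` then follows from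
`integral_one_add_cos_mul_cos_cayleyAngle` below).

* §1 the chart `Φ(θ) = L tan(θ/2)`: derivative `L/(2cos²(θ/2)) = L/(1 + cos θ)`, injective on `(−π, π)`, onto `ℝ`, inverse
  `2·arctan(·/L)`; the angle functions `cos θ(ξ) = (L² − ξ²)/(L² + ξ²)`, `sin θ(ξ) = 2Lξ/(L² + ξ²)`, `1 + cos θ(ξ) = 2L²/(L² + ξ²)`,
  and the weight `L² + Φ(θ)² = 2L²/(1 + cos θ)`;
* §2 **change of variables** `∫_ℝ g(ξ) dξ = ∫_{(−π,π)} Φ′(θ)·g(Φ θ) dθ` (no integrability hypothesis: Mathlib's Jacobian formula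
  `integral_image_eq_integral_abs_deriv_smul`) and its weighted forms «`w dξ = 2L³(1 + cos θ)⁻² dθ`»:
  `∫ w·g = ∫_{(−π,π)} 2L³(1 + cos θ)⁻²·g(Φ θ)`, `‖δ‖²_w = 2L³∫(δ∘Φ)²(1 + cos θ)⁻²`, **(E1b)** `‖δ′‖²_w = 2L·‖∂_θ(δ∘Φ)‖²_{L²(dθ)}`,
  and the frame pairing `⟨φ, e_n⟩_w = 2L³∫_{(−π,π)} φ(Φ θ)·sin nθ/(1 + cos θ) dθ`;
* §3 **(E1a)** `⟨e_n, e_m⟩_w = ∫(L² + ξ²)·e_n·e_m dξ = 2L³π·δ_{nm}` (`n ≥ 1`), from `∫_{−π}^{π} sin nθ sin mθ dθ = π δ_{nm}`;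
* §4 the frame functions on `ℝ`: rational form, oddness, bound `|e_n| ≤ 2L²/(L² + ξ²)`, smoothness, integrability;
* §5 `∫₀^x (1 + cos θ(s))·cos nθ(s) ds = (L/n)·sin nθ(x)` and `∫₀^x (1 + cos θ(s))·sin nθ(s) ds = (L/n)(1 − cos nθ(x))`
  (`θ′(s) = (1 + cos θ(s))/L`) — with (E2) this is the velocity clause `𝒰e_n = −(L/n) sin nθ` of the price memo.
Pure calculus; no definition, no named fact; MODEL frame bookkeeping only.
-/

noncomputable section

namespace Summit.NavierStokesRegularity.OSWSelfSimilar
namespace SheetRCayleySubstitution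

open _root_.MeasureTheory _root_.Set _root_.Filter _root_.Real
open scoped Real Topology

/-! ### §1 The chart `Φ(θ) = L·tan(θ/2)` on `(−π, π)` and the angle `θ(ξ) = 2·arctan(ξ/L)` -/

/-- On `(−π, π)` the half angle lies in `(−π/2, π/2)`. [folklore] -/
theorem half_mem_Ioo {θ : ℝ} (hθ : θ ∈ Ioo (-π) π) : θ / 2 ∈ Ioo (-(π / 2)) (π / 2) := by
  constructor <;> linarith [hθ.1, hθ.2]

/-- `cos(θ/2) > 0` for `θ ∈ (−π, π)`. [folklore] -/
theorem cos_half_pos {θ : ℝ} (hθ : θ ∈ Ioo (-π) π) : 0 < cos (θ / 2) :=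
  cos_pos_of_mem_Ioo (half_mem_Ioo hθ)

/-- `1 + cos θ = 2cos²(θ/2)`. [folklore] -/
theorem one_add_cos_eq (θ : ℝ) : 1 + cos θ = 2 * cos (θ / 2) ^ 2 := by
  rw [cos_sq (θ / 2), mul_div_cancel₀ θ two_ne_zero]; ring

/-- `1 + cos θ > 0` on `(−π, π)`. [folklore] -/
theorem one_add_cos_pos {θ : ℝ} (hθ : θ ∈ Ioo (-π) π) : 0 < 1 + cos θ := by
  rw [one_add_cos_eq]; have := cos_half_pos hθ; positivity

/-- The chart `Φ(θ) = L·tan(θ/2)` has derivative `L/(2cos²(θ/2))` at every `θ ∈ (−π, π)`. [folklore] -/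
theorem hasDerivAt_cayley (L : ℝ) {θ : ℝ} (hθ : θ ∈ Ioo (-π) π) :
    HasDerivAt (fun θ : ℝ => L * tan (θ / 2)) (L / (2 * cos (θ / 2) ^ 2)) θ := by
  have hc : cos (θ / 2) ≠ 0 := (cos_half_pos hθ).ne'
  have h1 : HasDerivAt (fun θ : ℝ => θ / 2) (1 / 2) θ := by
    simpa using (hasDerivAt_id θ).div_const 2
  have h2 := (Real.hasDerivAt_tan hc).comp θ h1
  refine (h2.const_mul L).congr_deriv ?_
  field_simp

/-- The same derivative written with the full angle: `L/(2cos²(θ/2)) = L/(1 + cos θ)`. [folklore] -/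
theorem cayley_deriv_eq (L θ : ℝ) : L / (2 * cos (θ / 2) ^ 2) = L / (1 + cos θ) := by
  rw [one_add_cos_eq]

/-- `Φ` is injective on `(−π, π)` (`L ≠ 0`). [folklore] -/
theorem injOn_cayley {L : ℝ} (hL : L ≠ 0) : InjOn (fun θ : ℝ => L * tan (θ / 2)) (Ioo (-π) π) := by
  intro a ha b hb hab
  have h : tan (a / 2) = tan (b / 2) := mul_left_cancel₀ hL hab
  have := Real.injOn_tan (half_mem_Ioo ha) (half_mem_Ioo hb) h
  linarith

/-- The angle `θ(ξ) = 2·arctan(ξ/L)` lies in `(−π, π)`. [folklore] -/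
theorem cayleyAngle_mem_Ioo (L ξ : ℝ) : 2 * arctan (ξ / L) ∈ Ioo (-π) π := by
  constructor <;> linarith [arctan_lt_pi_div_two (ξ / L), neg_pi_div_two_lt_arctan (ξ / L)]

/-- `Φ(θ(ξ)) = ξ`: `L·tan(arctan(ξ/L)) = ξ` (`L ≠ 0`). [folklore] -/
theorem cayley_cayleyAngle {L : ℝ} (hL : L ≠ 0) (ξ : ℝ) : L * tan (2 * arctan (ξ / L) / 2) = ξ := by
  rw [mul_div_cancel_left₀ _ (two_ne_zero), tan_arctan]; field_simp

/-- `θ(Φ(θ)) = θ` on `(−π, π)`: `2·arctan(tan(θ/2)) = θ` (`L ≠ 0`). [folklore] -/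
theorem cayleyAngle_cayley {L : ℝ} (hL : L ≠ 0) {θ : ℝ} (hθ : θ ∈ Ioo (-π) π) :
    2 * arctan (L * tan (θ / 2) / L) = θ := by
  rw [mul_div_cancel_left₀ _ hL, arctan_tan (half_mem_Ioo hθ).1 (half_mem_Ioo hθ).2]; ring

/-- `Φ` maps `(−π, π)` ONTO `ℝ`. [folklore] -/
theorem image_cayley {L : ℝ} (hL : L ≠ 0) : (fun θ : ℝ => L * tan (θ / 2)) '' Ioo (-π) π = univ := by
  refine eq_univ_of_forall fun ξ => ⟨2 * arctan (ξ / L), cayleyAngle_mem_Ioo L ξ, ?_⟩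
  exact cayley_cayleyAngle hL ξ

/-- `cos θ(ξ) = (L² − ξ²)/(L² + ξ²)`. [folklore] -/
theorem cos_cayleyAngle {L : ℝ} (hL : L ≠ 0) (ξ : ℝ) :
    cos (2 * arctan (ξ / L)) = (L ^ 2 - ξ ^ 2) / (L ^ 2 + ξ ^ 2) := by
  rw [cos_two_mul, cos_sq_arctan]
  have : L ^ 2 + ξ ^ 2 ≠ 0 := by positivity
  field_simp
  ring

/-- `sin θ(ξ) = 2Lξ/(L² + ξ²)`. [folklore] -/
theorem sin_cayleyAngle {L : ℝ} (hL : L ≠ 0) (ξ : ℝ) :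
    sin (2 * arctan (ξ / L)) = 2 * L * ξ / (L ^ 2 + ξ ^ 2) := by
  have hc2 := cos_sq_arctan (ξ / L)
  have hs : sin (arctan (ξ / L)) = ξ / L * cos (arctan (ξ / L)) := by
    rw [← tan_mul_cos (cos_arctan_pos _).ne', tan_arctan]
  rw [sin_two_mul, hs]
  have h3 : L ^ 2 + ξ ^ 2 ≠ 0 := by positivity
  calc 2 * (ξ / L * cos (arctan (ξ / L))) * cos (arctan (ξ / L))
      = 2 * (ξ / L) * cos (arctan (ξ / L)) ^ 2 := by ring
    _ = 2 * L * ξ / (L ^ 2 + ξ ^ 2) := by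
      rw [hc2]
      field_simp

/-- `1 + cos θ(ξ) = 2L²/(L² + ξ²)`. [folklore] -/
theorem one_add_cos_cayleyAngle {L : ℝ} (hL : L ≠ 0) (ξ : ℝ) :
    1 + cos (2 * arctan (ξ / L)) = 2 * L ^ 2 / (L ^ 2 + ξ ^ 2) := by
  rw [cos_cayleyAngle hL]
  have : L ^ 2 + ξ ^ 2 ≠ 0 := by positivity
  field_simp
  ring

/-- The derivative of the angle: `θ′(ξ) = 2L/(L² + ξ²) = (1 + cos θ(ξ))/L`. [folklore] -/
theorem hasDerivAt_cayleyAngle {L : ℝ} (hL : L ≠ 0) (ξ : ℝ) :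
    HasDerivAt (fun ξ : ℝ => 2 * arctan (ξ / L)) (2 * L / (L ^ 2 + ξ ^ 2)) ξ := by
  have h1 : HasDerivAt (fun ξ : ℝ => ξ / L) (1 / L) ξ := by
    simpa using (hasDerivAt_id ξ).div_const L
  have h2 := (Real.hasDerivAt_arctan (ξ / L)).comp ξ h1
  refine (h2.const_mul 2).congr_deriv ?_
  have : L ^ 2 + ξ ^ 2 ≠ 0 := by positivity
  field_simp

/-- The weight in the chart: `L² + Φ(θ)² = L²/cos²(θ/2)` on `(−π, π)`. [folklore] -/
theorem weight_cayley (L : ℝ) {θ : ℝ} (hθ : θ ∈ Ioo (-π) π) :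
    L ^ 2 + (L * tan (θ / 2)) ^ 2 = L ^ 2 / cos (θ / 2) ^ 2 := by
  have hc : cos (θ / 2) ≠ 0 := (cos_half_pos hθ).ne'
  rw [mul_pow, ← mul_one_add (L ^ 2), ← inv_one_add_tan_sq hc]
  field_simp

/-- The weight in the chart, full-angle form: `L² + Φ(θ)² = 2L²/(1 + cos θ)` on `(−π, π)`. [folklore] -/
theorem weight_cayley' (L : ℝ) {θ : ℝ} (hθ : θ ∈ Ioo (-π) π) :
    L ^ 2 + (L * tan (θ / 2)) ^ 2 = 2 * L ^ 2 / (1 + cos θ) := by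
  rw [weight_cayley L hθ, one_add_cos_eq]
  have hc : cos (θ / 2) ≠ 0 := (cos_half_pos hθ).ne'
  field_simp

/-! ### §2 Change of variables `∫_ℝ g = ∫_{(−π,π)} Φ′·(g∘Φ)` and the weighted forms -/

/-- **Change of variables along the Cayley chart** (no integrability hypothesis; both sides are `0` together when the
integrand is not integrable): `∫_ℝ g(ξ) dξ = ∫_{θ ∈ (−π,π)} (L/(2cos²(θ/2)))·g(L tan(θ/2)) dθ`, `L > 0`. [folklore] -/
theorem integral_comp_cayley {L : ℝ} (hL : 0 < L) (g : ℝ → ℝ) :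
    ∫ ξ, g ξ = ∫ θ in Ioo (-π) π, (L / (2 * cos (θ / 2) ^ 2)) * g (L * tan (θ / 2)) := by
  have hderiv : ∀ θ ∈ Ioo (-π) π,
      HasDerivWithinAt (fun θ : ℝ => L * tan (θ / 2)) (L / (2 * cos (θ / 2) ^ 2)) (Ioo (-π) π) θ :=
    fun θ hθ => (hasDerivAt_cayley L hθ).hasDerivWithinAt
  have h := integral_image_eq_integral_abs_deriv_smul measurableSet_Ioo hderiv (injOn_cayley hL.ne') g
  rw [image_cayley hL.ne', setIntegral_univ] at h
  rw [h]
  refine setIntegral_congr_fun measurableSet_Ioo fun θ _ => ?_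
  rw [smul_eq_mul, abs_of_nonneg (by positivity)]

/-- Integrability transfers along the chart: `g ∈ L¹(ℝ)` iff `θ ↦ Φ′(θ)·g(Φ θ)` is integrable on `(−π, π)`. [folklore] -/
theorem integrable_iff_integrableOn_comp_cayley {L : ℝ} (hL : 0 < L) (g : ℝ → ℝ) :
    Integrable g ↔ IntegrableOn (fun θ => (L / (2 * cos (θ / 2) ^ 2)) * g (L * tan (θ / 2))) (Ioo (-π) π) := by
  have hderiv : ∀ θ ∈ Ioo (-π) π,
      HasDerivWithinAt (fun θ : ℝ => L * tan (θ / 2)) (L / (2 * cos (θ / 2) ^ 2)) (Ioo (-π) π) θ :=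
    fun θ hθ => (hasDerivAt_cayley L hθ).hasDerivWithinAt
  have h := integrableOn_image_iff_integrableOn_abs_deriv_smul measurableSet_Ioo hderiv (injOn_cayley hL.ne') g
  rw [image_cayley hL.ne', integrableOn_univ] at h
  rw [h]
  refine integrableOn_congr_fun (fun θ _ => ?_) measurableSet_Ioo
  rw [smul_eq_mul, abs_of_nonneg (by positivity)]

/-- **«`w dξ = 2L³(1 + cos θ)⁻² dθ`»**: `∫(L² + ξ²)·g(ξ) dξ = ∫_{(−π,π)} (2L³/(1 + cos θ)²)·g(L tan(θ/2)) dθ`. [folklore] -/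
theorem integral_weight_mul_comp_cayley {L : ℝ} (hL : 0 < L) (g : ℝ → ℝ) :
    ∫ ξ, (L ^ 2 + ξ ^ 2) * g ξ = ∫ θ in Ioo (-π) π, (2 * L ^ 3 / (1 + cos θ) ^ 2) * g (L * tan (θ / 2)) := by
  rw [integral_comp_cayley hL]
  refine setIntegral_congr_fun measurableSet_Ioo fun θ hθ => ?_
  have hc : cos (θ / 2) ≠ 0 := (cos_half_pos hθ).ne'
  rw [weight_cayley L hθ, one_add_cos_eq]
  field_simp

/-- The weighted `L²` norm in the chart: `‖δ‖²_w = ∫(L² + ξ²)δ² dξ = 2L³·∫_{(−π,π)} δ(L tan(θ/2))²/(1 + cos θ)² dθ`. [folklore] -/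
theorem integral_weight_mul_sq_comp_cayley {L : ℝ} (hL : 0 < L) (δ : ℝ → ℝ) :
    ∫ ξ, (L ^ 2 + ξ ^ 2) * δ ξ ^ 2 = 2 * L ^ 3 * ∫ θ in Ioo (-π) π, δ (L * tan (θ / 2)) ^ 2 / (1 + cos θ) ^ 2 := by
  rw [integral_weight_mul_comp_cayley hL, ← integral_const_mul]
  refine setIntegral_congr_fun measurableSet_Ioo fun θ _ => ?_
  ring

/-- **(E1b)** `‖δ′‖²_w = 2L·‖∂_θ(δ∘Φ)‖²_{L²(dθ)}`: for differentiable `δ`,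
`∫(L² + ξ²)·δ′(ξ)² dξ = 2L·∫_{(−π,π)} (d/dθ[δ(L tan(θ/2))])² dθ`. [folklore] -/
theorem integral_weight_mul_deriv_sq_comp_cayley {L : ℝ} (hL : 0 < L) {δ : ℝ → ℝ} (hδ : Differentiable ℝ δ) :
    ∫ ξ, (L ^ 2 + ξ ^ 2) * deriv δ ξ ^ 2 =
      2 * L * ∫ θ in Ioo (-π) π, deriv (fun θ => δ (L * tan (θ / 2))) θ ^ 2 := by
  rw [integral_comp_cayley hL, ← integral_const_mul]
  refine setIntegral_congr_fun measurableSet_Ioo fun θ hθ => ?_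
  have hc : cos (θ / 2) ≠ 0 := (cos_half_pos hθ).ne'
  have hchain : HasDerivAt (fun θ => δ (L * tan (θ / 2)))
      (deriv δ (L * tan (θ / 2)) * (L / (2 * cos (θ / 2) ^ 2))) θ :=
    (hδ _).hasDerivAt.comp θ (hasDerivAt_cayley L hθ)
  rw [hchain.deriv, weight_cayley L hθ]
  field_simp

/-- The frame pairing in the chart: `⟨φ, e_n⟩_w = ∫(L² + ξ²)·φ·e_n dξ = 2L³·∫_{(−π,π)} φ(L tan(θ/2))·sin nθ/(1 + cos θ) dθ`
(the `e`-frame coefficients of `φ` are sine coefficients of `(φ∘Φ)/(1 + cos θ)`; PRICE-impl1 (E5)). [folklore] -/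
theorem integral_weight_mul_frame_comp_cayley {L : ℝ} (hL : 0 < L) (φ : ℝ → ℝ) (n : ℕ) :
    ∫ ξ, (L ^ 2 + ξ ^ 2) * (φ ξ * ((1 + cos (2 * arctan (ξ / L))) * sin (n * (2 * arctan (ξ / L))))) =
      2 * L ^ 3 * ∫ θ in Ioo (-π) π, φ (L * tan (θ / 2)) * sin (n * θ) / (1 + cos θ) := by
  rw [integral_weight_mul_comp_cayley hL, ← integral_const_mul]
  refine setIntegral_congr_fun measurableSet_Ioo fun θ hθ => ?_
  have h1 : (1 + cos θ) ≠ 0 := (one_add_cos_pos hθ).ne'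
  simp only [cayleyAngle_cayley hL.ne' hθ]
  field_simp

/-! ### §3 (E1a): orthogonality of the frame functions -/

/-- `∫_{−π}^{π} cos(kθ) dθ = 0` for a nonzero integer `k`. [folklore] -/
theorem integral_cos_int_mul {k : ℤ} (hk : k ≠ 0) : ∫ θ in (-π)..π, cos (k * θ) = 0 := by
  have hk' : (k : ℝ) ≠ 0 := Int.cast_ne_zero.2 hk
  have hF : ∀ θ ∈ uIcc (-π) π, HasDerivAt (fun θ => sin (k * θ) / k) (cos (k * θ)) θ := by
    intro θ _
    have h1 : HasDerivAt (fun θ : ℝ => (k : ℝ) * θ) ((k : ℝ) * 1) θ := (hasDerivAt_id θ).const_mul (k : ℝ)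
    have h2 : HasDerivAt (fun θ : ℝ => sin ((k : ℝ) * θ)) (cos ((k : ℝ) * θ) * ((k : ℝ) * 1)) θ :=
      (Real.hasDerivAt_sin _).comp θ h1
    refine (h2.div_const (k : ℝ)).congr_deriv ?_
    field_simp
  rw [intervalIntegral.integral_eq_sub_of_hasDerivAt hF
    ((by fun_prop : Continuous fun θ : ℝ => cos ((k : ℝ) * θ)).intervalIntegrable _ _)]
  rw [show (k : ℝ) * -π = -(k * π) by ring, sin_neg, sin_int_mul_pi]
  simp

/-- `∫_{−π}^{π} sin(nθ)sin(mθ) dθ = π·δ_{nm}` for naturals `n ≥ 1`, `m`. [folklore] -/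
theorem integral_sin_mul_sin {n m : ℕ} (hn : n ≠ 0) :
    ∫ θ in (-π)..π, sin (n * θ) * sin (m * θ) = if n = m then π else 0 := by
  have hprod : ∀ θ : ℝ, sin (n * θ) * sin (m * θ) =
      (cos (((n : ℤ) - m : ℤ) * θ) - cos (((n : ℤ) + m : ℤ) * θ)) / 2 := by
    intro θ
    push_cast
    rw [sub_mul, add_mul, cos_sub, cos_add]
    ring
  simp_rw [hprod]
  rw [intervalIntegral.integral_div, intervalIntegral.integral_sub
    ((by fun_prop : Continuous fun θ : ℝ => cos ((((n : ℤ) - m : ℤ) : ℝ) * θ)).intervalIntegrable _ _)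
    ((by fun_prop : Continuous fun θ : ℝ => cos ((((n : ℤ) + m : ℤ) : ℝ) * θ)).intervalIntegrable _ _),
    integral_cos_int_mul (by omega : ((n : ℤ) + m : ℤ) ≠ 0), sub_zero]
  split_ifs with h
  · subst h
    simp only [sub_self, Int.cast_zero, zero_mul, cos_zero, intervalIntegral.integral_const, smul_eq_mul, mul_one]
    ring
  · rw [integral_cos_int_mul (by omega : ((n : ℤ) - m : ℤ) ≠ 0), zero_div]

/-- **(E1a) Orthogonality of the frame functions in `L²_w`**: with `e_n(ξ) = (1 + cos θ(ξ))·sin nθ(ξ)`, `θ(ξ) = 2·arctan(ξ/L)`,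
`⟨e_n, e_m⟩_w = ∫(L² + ξ²)·e_n(ξ)·e_m(ξ) dξ = 2L³π·δ_{nm}` (`n ≥ 1`, `L > 0`). [folklore] -/
theorem frame_orthogonal {L : ℝ} (hL : 0 < L) {n m : ℕ} (hn : n ≠ 0) :
    ∫ ξ, (L ^ 2 + ξ ^ 2) * (((1 + cos (2 * arctan (ξ / L))) * sin (n * (2 * arctan (ξ / L)))) *
        ((1 + cos (2 * arctan (ξ / L))) * sin (m * (2 * arctan (ξ / L))))) =
      if n = m then 2 * L ^ 3 * π else 0 := by
  rw [integral_weight_mul_comp_cayley hL]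
  have heq : EqOn (fun θ => 2 * L ^ 3 / (1 + cos θ) ^ 2 *
        ((1 + cos (2 * arctan (L * tan (θ / 2) / L))) * sin (n * (2 * arctan (L * tan (θ / 2) / L))) *
          ((1 + cos (2 * arctan (L * tan (θ / 2) / L))) * sin (m * (2 * arctan (L * tan (θ / 2) / L))))))
      (fun θ => 2 * L ^ 3 * (sin (n * θ) * sin (m * θ))) (Ioo (-π) π) := by
    intro θ hθ
    have h1 : (1 + cos θ) ≠ 0 := (one_add_cos_pos hθ).ne'
    simp only [cayleyAngle_cayley hL.ne' hθ]
    field_simp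
  rw [setIntegral_congr_fun measurableSet_Ioo heq, integral_const_mul, ← integral_Ioc_eq_integral_Ioo,
    ← intervalIntegral.integral_of_le (by linarith [pi_pos] : -π ≤ π), integral_sin_mul_sin hn]
  split_ifs <;> ring

/-- The frame normalisation: `‖e_n‖²_w = 2L³π` (`n ≥ 1`). [folklore] -/
theorem frame_weightedSq {L : ℝ} (hL : 0 < L) {n : ℕ} (hn : n ≠ 0) :
    ∫ ξ, (L ^ 2 + ξ ^ 2) * ((1 + cos (2 * arctan (ξ / L))) * sin (n * (2 * arctan (ξ / L)))) ^ 2 =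
      2 * L ^ 3 * π := by
  have h := frame_orthogonal hL (m := n) hn
  simp only [if_true] at h
  simpa only [pow_two] using h

/-! ### §4 The frame functions as functions on `ℝ` -/

/-- Rational form: `e_n(ξ) = (2L²/(L² + ξ²))·sin nθ(ξ)`. [folklore] -/
theorem frame_eq {L : ℝ} (hL : L ≠ 0) (n : ℕ) (ξ : ℝ) :
    (1 + cos (2 * arctan (ξ / L))) * sin (n * (2 * arctan (ξ / L))) =
      2 * L ^ 2 / (L ^ 2 + ξ ^ 2) * sin (n * (2 * arctan (ξ / L))) := by
  rw [one_add_cos_cayleyAngle hL]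

/-- The frame functions are ODD. [folklore] -/
theorem frame_neg (L : ℝ) (n : ℕ) (ξ : ℝ) :
    (1 + cos (2 * arctan (-ξ / L))) * sin (n * (2 * arctan (-ξ / L))) =
      -((1 + cos (2 * arctan (ξ / L))) * sin (n * (2 * arctan (ξ / L)))) := by
  rw [neg_div, arctan_neg, mul_neg, cos_neg, mul_neg, sin_neg, mul_neg]

/-- The companion functions `(1 + cos θ)cos nθ` are EVEN. [folklore] -/
theorem coframe_neg (L : ℝ) (n : ℕ) (ξ : ℝ) :
    (1 + cos (2 * arctan (-ξ / L))) * cos (n * (2 * arctan (-ξ / L))) =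
      (1 + cos (2 * arctan (ξ / L))) * cos (n * (2 * arctan (ξ / L))) := by
  rw [neg_div, arctan_neg, mul_neg, cos_neg, mul_neg, cos_neg]

/-- Bound: `|e_n(ξ)| ≤ 2L²/(L² + ξ²)`. [folklore] -/
theorem abs_frame_le {L : ℝ} (hL : L ≠ 0) (n : ℕ) (ξ : ℝ) :
    |(1 + cos (2 * arctan (ξ / L))) * sin (n * (2 * arctan (ξ / L)))| ≤ 2 * L ^ 2 / (L ^ 2 + ξ ^ 2) := by
  rw [frame_eq hL, abs_mul, abs_of_nonneg (by positivity : (0:ℝ) ≤ 2 * L ^ 2 / (L ^ 2 + ξ ^ 2))]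
  exact mul_le_of_le_one_right (by positivity) (abs_sin_le_one _)

/-- Bound for the companions: `|(1 + cos θ)cos nθ| ≤ 2L²/(L² + ξ²)`. [folklore] -/
theorem abs_coframe_le {L : ℝ} (hL : L ≠ 0) (n : ℕ) (ξ : ℝ) :
    |(1 + cos (2 * arctan (ξ / L))) * cos (n * (2 * arctan (ξ / L)))| ≤ 2 * L ^ 2 / (L ^ 2 + ξ ^ 2) := by
  rw [one_add_cos_cayleyAngle hL, abs_mul, abs_of_nonneg (by positivity : (0:ℝ) ≤ 2 * L ^ 2 / (L ^ 2 + ξ ^ 2))]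
  exact mul_le_of_le_one_right (by positivity) (abs_cos_le_one _)

/-- The frame functions are smooth. [folklore] -/
theorem contDiff_frame (L : ℝ) (n : ℕ) {k : WithTop ℕ∞} :
    ContDiff ℝ k fun ξ : ℝ => (1 + cos (2 * arctan (ξ / L))) * sin (n * (2 * arctan (ξ / L))) := by
  have hθ : ContDiff ℝ k fun ξ : ℝ => 2 * arctan (ξ / L) :=
    contDiff_const.mul (contDiff_arctan.comp (contDiff_id.div_const L))
  exact (contDiff_const.add (Real.contDiff_cos.comp hθ)).mul (Real.contDiff_sin.comp (contDiff_const.mul hθ))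

/-- The companion functions are smooth. [folklore] -/
theorem contDiff_coframe (L : ℝ) (n : ℕ) {k : WithTop ℕ∞} :
    ContDiff ℝ k fun ξ : ℝ => (1 + cos (2 * arctan (ξ / L))) * cos (n * (2 * arctan (ξ / L))) := by
  have hθ : ContDiff ℝ k fun ξ : ℝ => 2 * arctan (ξ / L) :=
    contDiff_const.mul (contDiff_arctan.comp (contDiff_id.div_const L))
  exact (contDiff_const.add (Real.contDiff_cos.comp hθ)).mul (Real.contDiff_cos.comp (contDiff_const.mul hθ))

/-- The frame functions are integrable on `ℝ` (`L > 0`). [folklore] -/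
theorem integrable_frame {L : ℝ} (hL : 0 < L) (n : ℕ) :
    Integrable fun ξ : ℝ => (1 + cos (2 * arctan (ξ / L))) * sin (n * (2 * arctan (ξ / L))) := by
  refine Integrable.mono' ((SheetRWeightedEmbeddings.integrable_inv_sq_add_sq hL).const_mul (2 * L ^ 2))
    (contDiff_frame L n (k := 0)).continuous.aestronglyMeasurable (Eventually.of_forall fun ξ => ?_)
  rw [← div_eq_mul_inv]
  exact abs_frame_le hL.ne' n ξ

/-- The companion functions are integrable on `ℝ` (`L > 0`). [folklore] -/
theorem integrable_coframe {L : ℝ} (hL : 0 < L) (n : ℕ) :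
    Integrable fun ξ : ℝ => (1 + cos (2 * arctan (ξ / L))) * cos (n * (2 * arctan (ξ / L))) := by
  refine Integrable.mono' ((SheetRWeightedEmbeddings.integrable_inv_sq_add_sq hL).const_mul (2 * L ^ 2))
    (contDiff_coframe L n (k := 0)).continuous.aestronglyMeasurable (Eventually.of_forall fun ξ => ?_)
  rw [← div_eq_mul_inv]
  exact abs_coframe_le hL.ne' n ξ

/-! ### §5 The `H`-free half of the velocity clause: primitives of `(1 + cos θ)cos nθ` and `(1 + cos θ)sin nθ` in `ξ` -/

/-- **`∫₀^x (1 + cos θ(s))·cos nθ(s) ds = (L/n)·sin nθ(x)`** (`θ(s) = 2·arctan(s/L)`, `θ′ = (1 + cos θ)/L`, `n ≥ 1`, `L ≠ 0`). With (E2),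
`H e_n = −(1 + cos θ)cos nθ`, this is the velocity clause `𝒰e_n(x) = ∫₀^x H e_n = −(L/n) sin nθ(x)` of PRICE-impl1 §1 (E2). [folklore] -/
theorem integral_one_add_cos_mul_cos_cayleyAngle {L : ℝ} (hL : L ≠ 0) {n : ℕ} (hn : n ≠ 0) (x : ℝ) :
    ∫ s in (0:ℝ)..x, (1 + cos (2 * arctan (s / L))) * cos (n * (2 * arctan (s / L))) =
      L / n * sin (n * (2 * arctan (x / L))) := by
  have hn' : (n : ℝ) ≠ 0 := Nat.cast_ne_zero.2 hn
  have hF : ∀ s ∈ uIcc (0:ℝ) x, HasDerivAt (fun s => L / n * sin (n * (2 * arctan (s / L))))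
      ((1 + cos (2 * arctan (s / L))) * cos (n * (2 * arctan (s / L)))) s := by
    intro s _
    have h1 : HasDerivAt (fun s : ℝ => (n : ℝ) * (2 * arctan (s / L))) ((n : ℝ) * (2 * L / (L ^ 2 + s ^ 2))) s :=
      (hasDerivAt_cayleyAngle hL s).const_mul (n : ℝ)
    have h2 : HasDerivAt (fun s : ℝ => sin ((n : ℝ) * (2 * arctan (s / L))))
        (cos ((n : ℝ) * (2 * arctan (s / L))) * ((n : ℝ) * (2 * L / (L ^ 2 + s ^ 2)))) s :=
      (Real.hasDerivAt_sin _).comp s h1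
    refine (h2.const_mul (L / n)).congr_deriv ?_
    rw [one_add_cos_cayleyAngle hL]
    have : L ^ 2 + s ^ 2 ≠ 0 := by positivity
    field_simp
  rw [intervalIntegral.integral_eq_sub_of_hasDerivAt hF
    ((contDiff_coframe L n (k := 0)).continuous.intervalIntegrable _ _)]
  simp

/-- `∫₀^x (1 + cos θ(s))·sin nθ(s) ds = (L/n)·(1 − cos nθ(x))` (`n ≥ 1`, `L ≠ 0`): the `ξ`-primitive of the frame function `e_n` itself.
[folklore] -/
theorem integral_frame_cayleyAngle {L : ℝ} (hL : L ≠ 0) {n : ℕ} (hn : n ≠ 0) (x : ℝ) :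
    ∫ s in (0:ℝ)..x, (1 + cos (2 * arctan (s / L))) * sin (n * (2 * arctan (s / L))) =
      L / n * (1 - cos (n * (2 * arctan (x / L)))) := by
  have hn' : (n : ℝ) ≠ 0 := Nat.cast_ne_zero.2 hn
  have hF : ∀ s ∈ uIcc (0:ℝ) x, HasDerivAt (fun s => L / n * (1 - cos (n * (2 * arctan (s / L)))))
      ((1 + cos (2 * arctan (s / L))) * sin (n * (2 * arctan (s / L)))) s := by
    intro s _
    have h1 : HasDerivAt (fun s : ℝ => (n : ℝ) * (2 * arctan (s / L))) ((n : ℝ) * (2 * L / (L ^ 2 + s ^ 2))) s :=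
      (hasDerivAt_cayleyAngle hL s).const_mul (n : ℝ)
    have h2 : HasDerivAt (fun s : ℝ => cos ((n : ℝ) * (2 * arctan (s / L))))
        (-sin ((n : ℝ) * (2 * arctan (s / L))) * ((n : ℝ) * (2 * L / (L ^ 2 + s ^ 2)))) s :=
      (Real.hasDerivAt_cos _).comp s h1
    refine ((h2.const_sub 1).const_mul (L / n)).congr_deriv ?_
    rw [one_add_cos_cayleyAngle hL]
    have : L ^ 2 + s ^ 2 ≠ 0 := by positivity
    field_simp
  rw [intervalIntegral.integral_eq_sub_of_hasDerivAt hF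
    ((contDiff_frame L n (k := 0)).continuous.intervalIntegrable _ _)]
  simp

end SheetRCayleySubstitution
end Summit.NavierStokesRegularity.OSWSelfSimilar
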